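import Summits.QuantumAdvantage.QuantumAdvantage.Theorems.GapDialDilution

/-!
# GapDial (4/4) — THE HALF LAW and the QUANTIZATION LAW of the feedback family

For EVERY cross matrix `M`, source `a`, readout `b` the feedback pair `(FF K M b, GG K a)` of part 2 has value `Φ = -2^{-K}·S`,
`S = Σ_{x ∈ Sol} (-1)^{x(b)}` a character sum over `Sol = {x : (I+M)x = e_a}` (a coset of `ker (I+M)`).
QUANTIZATION (`sum_sol_quantized`, `value_feedback_quantized`): `S ∈ {0, ±|Sol|}`.  COUNTING (`two_mul_card_sol_le`): `2·|Sol| ≤ 2^K`.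
HALF LAW (`abs_value_feedback_le_half`): `|Φ| ≤ 1/2` on the whole family; hence (`feedback_not_mem_gapYes_threeFifths`,
`feedback_not_mem_gapNo_threeFifths`) NO feedback pair — whatever the selector `M = M_w` — is an instance of the constant-gap rung
`GapSlice (3/5)` of part 1: the route's rung `GapRungThreeFifths` needs a planting OUTSIDE the feedback family.  [this lineage g9;
formal part of the cell critic's row-62 test «does an AC⁰[⊕]-hard function project to the sign of Φ at constant gap?» — not inside this family]
-/

set_option linter.dupNamespace false

noncomputable section

namespace Summit.QuantumAdvantage.QuantumAdvantage.Theorems.GapDial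

open Finset
open Literature.Computability.Complexity
open Literature.Computability.QuantumComplexity
open Literature.Computability.MetaComplexity
open Summit.QuantumAdvantage.QuantumAdvantage.Theorems.HintDial

namespace Automaton

open CubicForm (bit)
open BuzetChailloux (bxor zeroVec)
open Summit.QuantumAdvantage.QuantumAdvantage.Theorems.HintDial.Automaton

/-! ### ★ THE HALF LAW and the QUANTIZATION LAW of the feedback family (critic row 62's test, formal part)

For EVERY cross matrix `M`, source `a`, readout `b`: the feedback value is `Φ = -2^{-K}·S` with `S = Σ_{x ∈ Sol} (-1)^{x(b)}` a character
sum over the solution set `Sol = {x : (I+M)x = e_a}`, a coset of `ker (I+M)`.  (i) QUANTIZATION: `S ∈ {0, ±|Sol|}` (either some kernel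
vector flips the readout — an involution kills the sum — or the readout is constant on the coset).  (ii) COUNTING: `Sol ≠ ∅ ⇒ I+M ≠ 0 ⇒
2·|Sol| ≤ 2^K` (a solution translated by a moved vector is not a solution).  Hence `|Φ| ∈ {0} ∪ {|Sol|/2^K}` and `|Φ| ≤ 1/2` on the WHOLE
feedback family: NO feedback pair is an instance of the route's constant-gap rung `GapSlice (3/5)` — whatever the selector `M = M_w`.
So `GapRungThreeFifths` needs a planting outside the feedback family (genuinely cubic `f`, or a non-feedback dual pair). -/

section HalfLaw

variable {K : ℕ}

/-- the solution set `Sol(M,a) = {x : x ⊕ Mx = e_a}` of the feedback equation. -/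
def sol (M : Fin K → Fin K → Bool) (a : Fin K) : Finset (Fin K → Bool) :=
  univ.filter fun x => bxor x (mv M x) = sgl a

/-- the feedback sum is the character sum over `Sol`. -/
theorem fsum_eq_sum_sol (M : Fin K → Fin K → Bool) (a b : Fin K) :
    ∑ x : Fin K → Bool, (if bxor x (mv M x) = sgl a then signOf (x b) else 0) = ∑ x ∈ sol M a, signOf (x b) := by
  rw [sol, Finset.sum_filter]

/-- two solutions differ by a kernel vector: `M (x ⊕ x') = x ⊕ x'`. -/
theorem mv_bxor_of_mem_sol {M : Fin K → Fin K → Bool} {a : Fin K} {x x' : Fin K → Bool}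
    (hx : x ∈ sol M a) (hx' : x' ∈ sol M a) : mv M (bxor x x') = bxor x x' := by
  rw [sol, mem_filter] at hx hx'
  rw [mv_bxor]
  funext i
  have h1 := congrFun hx.2 i
  have h2 := congrFun hx'.2 i
  simp only [bxor] at h1 h2 ⊢
  revert h1 h2
  cases x i <;> cases x' i <;> cases mv M x i <;> cases mv M x' i <;> simp

/-- a solution translated by a kernel vector is a solution. -/
theorem bxor_mem_sol {M : Fin K → Fin K → Bool} {a : Fin K} {v x : Fin K → Bool}
    (hv : mv M v = v) (hx : x ∈ sol M a) : bxor v x ∈ sol M a := by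
  rw [sol, mem_filter] at hx ⊢
  refine ⟨mem_univ _, ?_⟩
  rw [mv_bxor, hv, ← hx.2]
  funext i
  simp only [bxor]
  cases v i <;> cases x i <;> cases mv M x i <;> rfl

/-- a solution translated by a MOVED vector is not a solution. -/
theorem bxor_not_mem_sol {M : Fin K → Fin K → Bool} {a : Fin K} {x u : Fin K → Bool}
    (hx : x ∈ sol M a) (hu : mv M u ≠ u) : bxor u x ∉ sol M a := by
  intro h
  apply hu
  have e := mv_bxor_of_mem_sol h hx
  have hc : bxor (bxor u x) x = u := by
    rw [BuzetChailloux.bxor_comm u x, BuzetChailloux.bxor_comm (bxor x u) x, BuzetChailloux.bxor_bxor_cancel_left]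
  rw [hc] at e
  exact e

/-- if `Sol ≠ ∅` then `I + M ≠ 0`: some vector is moved by `M` (because `e_a ≠ 0`). -/
theorem exists_moved_of_mem_sol {M : Fin K → Fin K → Bool} {a : Fin K} {x : Fin K → Bool} (hx : x ∈ sol M a) :
    ∃ u : Fin K → Bool, mv M u ≠ u := by
  by_contra h
  push Not at h
  rw [sol, mem_filter] at hx
  have := congrFun hx.2 a
  rw [h x] at this
  simp [bxor, sgl] at this

/-- ★ COUNTING HALF: `2·|Sol| ≤ 2^K`. -/
theorem two_mul_card_sol_le (M : Fin K → Fin K → Bool) (a : Fin K) : 2 * (sol M a).card ≤ 2 ^ K := by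
  rcases (sol M a).eq_empty_or_nonempty with h | ⟨x₀, hx₀⟩
  · simp [h]
  obtain ⟨u, hu⟩ := exists_moved_of_mem_sol hx₀
  have hinj : Set.InjOn (fun x => bxor u x) (sol M a : Set (Fin K → Bool)) := fun x _ y _ hxy => by
    have := congrArg (bxor u) hxy
    simpa only [BuzetChailloux.bxor_bxor_cancel_left] using this
  have hdisj : Disjoint (sol M a) ((sol M a).image fun x => bxor u x) := by
    rw [Finset.disjoint_left]
    intro x hx hx'
    obtain ⟨y, hy, hyx⟩ := mem_image.1 hx'
    exact bxor_not_mem_sol hy hu (hyx ▸ hx)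
  have hcard : (sol M a ∪ (sol M a).image fun x => bxor u x).card = 2 * (sol M a).card := by
    rw [card_union_of_disjoint hdisj, card_image_of_injOn hinj]; ring
  calc 2 * (sol M a).card = (sol M a ∪ (sol M a).image fun x => bxor u x).card := hcard.symm
    _ ≤ (univ : Finset (Fin K → Bool)).card := card_le_card (subset_univ _)
    _ = 2 ^ K := by simp

/-- ★ QUANTIZATION LAW: the character sum over `Sol` is `0` or `±|Sol|`. -/
theorem sum_sol_quantized (M : Fin K → Fin K → Bool) (a b : Fin K) :
    ∑ x ∈ sol M a, signOf (x b) = 0 ∨ |∑ x ∈ sol M a, signOf (x b)| = (sol M a).card := by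
  by_cases hv : ∃ x ∈ sol M a, ∃ x' ∈ sol M a, x b ≠ x' b
  · left
    obtain ⟨x₁, h₁, x₁', h₁', hne⟩ := hv
    have hvker : mv M (bxor x₁ x₁') = bxor x₁ x₁' := mv_bxor_of_mem_sol h₁ h₁'
    have hvb : bxor x₁ x₁' b = true := by
      simp only [bxor]; revert hne; cases x₁ b <;> cases x₁' b <;> simp
    have hmem : ∀ x ∈ sol M a, bxor (bxor x₁ x₁') x ∈ sol M a := fun x hx => bxor_mem_sol hvker hx
    have hcancel : ∀ x ∈ sol M a, bxor (bxor x₁ x₁') (bxor (bxor x₁ x₁') x) = x := fun x _ =>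
      BuzetChailloux.bxor_bxor_cancel_left _ _
    have hS : ∑ x ∈ sol M a, signOf (x b) = ∑ x ∈ sol M a, -signOf (x b) := by
      refine Finset.sum_nbij' (fun x => bxor (bxor x₁ x₁') x) (fun x => bxor (bxor x₁ x₁') x) hmem hmem hcancel hcancel ?_
      intro x _
      show signOf (x b) = -signOf (xor (bxor x₁ x₁' b) (x b))
      rw [hvb]
      cases x b <;> simp
    rw [sum_neg_distrib] at hS
    linarith
  · right
    push Not at hv
    rcases (sol M a).eq_empty_or_nonempty with h | ⟨x₀, hx₀⟩
    · simp [h]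
    · rw [sum_congr rfl fun x hx => by rw [hv x hx x₀ hx₀], sum_const, nsmul_eq_mul, abs_mul, abs_signOf, mul_one,
        Nat.abs_cast]

/-- ★★ THE HALF LAW: every feedback pair has `|Φ| ≤ 1/2` (so none is an instance of the constant-gap rung `3/5`). -/
theorem abs_value_feedback_le_half (M : Fin K → Fin K → Bool) (a b : Fin K) :
    |(⟨K + K, FF K M b, GG K a⟩ : CubicANFPair).value| ≤ 1 / 2 := by
  rw [value_feedback, fsum_eq_sum_sol, abs_mul, abs_neg, abs_inv, abs_of_pos (by positivity : (0:ℝ) < 2 ^ K)]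
  have hS : |∑ x ∈ sol M a, signOf (x b)| ≤ (sol M a).card := by
    refine (abs_sum_le_sum_abs _ _).trans (le_of_eq ?_)
    rw [sum_congr rfl fun x _ => abs_signOf (x b), sum_const, nsmul_eq_mul, mul_one]
  have hc : (2 : ℝ) * (sol M a).card ≤ 2 ^ K := by exact_mod_cast two_mul_card_sol_le M a
  rw [inv_mul_le_iff₀ (by positivity : (0:ℝ) < 2 ^ K)]
  linarith

/-- the value is QUANTIZED: `Φ = 0` or `|Φ| = |Sol|/2^K` (a power of `1/2`, since `Sol` is a coset of a subgroup of `𝔽₂^K`). -/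
theorem value_feedback_quantized (M : Fin K → Fin K → Bool) (a b : Fin K) :
    (⟨K + K, FF K M b, GG K a⟩ : CubicANFPair).value = 0 ∨
      |(⟨K + K, FF K M b, GG K a⟩ : CubicANFPair).value| = (sol M a).card / (2 : ℝ) ^ K := by
  rw [value_feedback, fsum_eq_sum_sol]
  rcases sum_sol_quantized M a b with h | h
  · left; rw [h, mul_zero]
  · right
    rw [abs_mul, abs_neg, abs_inv, abs_of_pos (by positivity : (0:ℝ) < 2 ^ K), h, div_eq_inv_mul]

/-- COROLLARY: no feedback pair is a YES instance of the constant-gap rung `δ ≡ 3/5` … -/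
theorem feedback_not_mem_gapYes_threeFifths (M : Fin K → Fin K → Bool) (a b : Fin K) :
    (⟨K + K, FF K M b, GG K a⟩ : CubicANFPair) ∉ gapYes (fun _ => (3 : ℝ) / 5) := by
  intro h
  have h1 := abs_value_feedback_le_half M a b
  have h2 : (3 : ℝ) / 5 ≤ _ := h.2
  have h3 := le_abs_self ((⟨K + K, FF K M b, GG K a⟩ : CubicANFPair).value)
  linarith

/-- … nor a NO instance. -/
theorem feedback_not_mem_gapNo_threeFifths (M : Fin K → Fin K → Bool) (a b : Fin K) :
    (⟨K + K, FF K M b, GG K a⟩ : CubicANFPair) ∉ gapNo (fun _ => (3 : ℝ) / 5) := by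
  intro h
  have h1 := abs_value_feedback_le_half M a b
  have h2 : _ ≤ -((3 : ℝ) / 5) := h.2
  have h3 := neg_abs_le ((⟨K + K, FF K M b, GG K a⟩ : CubicANFPair).value)
  linarith

end HalfLaw

end Automaton

end Summit.QuantumAdvantage.QuantumAdvantage.Theorems.GapDial

end
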